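import Literature.NumberTheory.Automorphic.ReciprocityGLnProofs
import Literature.NumberTheory.Automorphic.AutomorphicRepsGLSatakeFlathProofs
import Literature.NumberTheory.GaloisRepresentations.ArtinRestriction
import Literature.NumberTheory.GaloisRepresentations.FrobeniusPlaces
import HarnessLib

/-!
# Descent of unramified local–global compatibility from `Γ_L` to `Γ_K` at completely split
# places (the read-off step of the patching argument for Harris–Lan–Taylor–Thorne's Cor. 7.14)

Topic `Literature/NumberTheory/Automorphic`.  A *proofs* file (theorems only: no definition, no
named fact) next to `ReciprocityGLnProofs`, written by the tenured seat of the named fact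
`Literature.NumberTheory.Automorphic.HarrisLanTaylorThorne2016.theoremA_existence`
(Harris–Lan–Taylor–Thorne 2016, Thm. A = Cor. 7.14, existence; printed proof p. 232: "This can be
deduced from Theorem 7.13 by using lemma 1 of [54]. (This is the same argument used in the proof
of theorem VII.1.9 of [29].)").  In that argument (Harris–Taylor, proof of Thm. VII.1.9, p. 231:
"Given any finite place `y` of `L` we can choose an imaginary quadratic extension `A/ℚ` such that
… `y` splits as `y'y''` in `LA` … If `y ∤ l` then
`[R_l(Π)|_{W_{F_y}}] = [R_l(Res^L_{F_A}(Π))|_{W_{F_{y'}}}] = [r_l(ı⁻¹Π_y)]`") the local behaviour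
of the patched representation `R` of `Γ_L` at `y` is READ OFF from that of its restriction to
`Γ_{LA}` at a place `y' ∣ y` of residue degree and ramification index one.  This file proves the
Galois-theoretic content of that step for the tree's carriers (`FramedGaloisRep.restrictField`
along `absGaloisRestrict K M : Γ_M →ₜ* Γ_K`, `IsUnramifiedAt`, `HasFrobCharpolyAt`, primes of
`\bar ℤ`, `IsArithFrobAt`, `Ideal.inertia`), complementing `ReciprocityGLnRestrictionProofs`
(the opposite, easy direction `K ⇒ M`):

* `Literature.NumberTheory.GaloisRepresentations.inertia_le_range_absGaloisRestrict` — **at a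
  place `v` of `K` unramified in the finite Galois extension `M/K`, every inertia group
  `I_𝔓 ≤ Γ_K`, `𝔓 ∣ v`, lies in the image `res(Γ_M)`** (`res(Γ_M) = Gal(K̄/e(M))` for a
  `K`-embedding `e` of `M`, `exists_mem_range_absGaloisRestrict_iff`; an element `γ` of `I_𝔓`
  restricts to an element of the inertia subgroup of `Gal(M/K)` at the prime `e⁻¹(𝔓) ∩ 𝓞 M`,
  which has order `e(v) = 1`, Mathlib `Ideal.card_inertia_eq_ramificationIdxIn`; so `γ` fixes
  `e(M)`).  This discharges, for unramified `v`, the hypothesis `hI : I_𝔓 ≤ res(Γ_M)` of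
  `exists_place_inert_of_not_mem_range` (`GaloisRepresentations/FrobeniusPlaces`).
* `Literature.NumberTheory.GaloisRepresentations.FramedGaloisRep.isUnramifiedAt_of_restrictField`
  — if `v` is unramified in `M` and `σ|_{Γ_M}` is unramified at every place of `M` above `v`,
  then `σ` is unramified at `v` (`res⁻¹(I_𝔓) = I_𝔔`, `comap_inertia_comap_absIntegersMap`).
* `Literature.NumberTheory.GaloisRepresentations.FramedGaloisRep.hasFrobCharpolyAt_of_restrictField`
  — if moreover the places of `M` above `v` have residue degree `1` and `σ|_{Γ_M}` has
  arithmetic-Frobenius characteristic polynomial `P` at each of them, then `σ` has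
  arithmetic-Frobenius characteristic polynomial `P` at `v` (a Frobenius of `Γ_M` at `𝔔 ∣ w`
  restricts to a Frobenius of `Γ_K` at `ι⁻¹ 𝔔 ∣ v` when `f(w|v) = 1`,
  `isArithFrobAt_absGaloisRestrict_of_inertiaDeg_eq_one`, and two Frobenii at the same prime
  differ by inertia, Mathlib `IsArithFrobAt.mul_inv_mem_inertia`).
* `Literature.NumberTheory.Automorphic.isGaloisCompatibleAt_of_restrictField` — **assembly** in
  the vocabulary of `ReciprocityGLn`/`ReciprocityGLnProofs`: if `v` splits completely in the
  Galois extension `L/K` (`e = f = 1`), `π` (on `GL_n(𝔸_K)`) has Satake parameter `α` at `v`,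
  the representation `Π` of `GL_n(𝔸_L)` has Satake parameter `α` at every `w ∣ v` (the
  base-change relation at split places, `exists_baseChange_cyclic_split` of `BaseChangeGLn`), and
  `r|_{Γ_L}` is compatible with `Π` at every `w ∣ v` (`IsGaloisCompatibleAt`), then `r` is
  compatible with `π` at `v`.  Compatibility of `r|_{Γ_L}` is in turn inherited from any
  representation conjugate to it (`isGaloisCompatibleAt_conj_iff` of `ReciprocityGLnProofs`), e.g.
  from `r_A = r_{p,ı}(BC(π))` under the isomorphism `R|_{Γ_{F_A}} ≅ r_A` produced by patching.

Everything here is proved; nothing is asserted about the existence of base change, of the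
representations, or of the patching (those are Arthur–Clozel's theorem, the named fact
`theoremA_existence`, and Sorensen's lemma respectively).

## References

* M. Harris, K.-W. Lan, R. Taylor, J. Thorne, *On the rigid cohomology of certain Shimura
  varieties*, Res. Math. Sci. 3:37 (2016), Cor. 7.14 and its proof (p. 232).
  [HarrisLanTaylorThorneRMS2016]
* M. Harris, R. Taylor, *The geometry and cohomology of some simple Shimura varieties*, Ann. of
  Math. Stud. 151 (2001), proof of Thm. VII.1.9 (pp. 228–231). [HarrisTaylor2001]
* J. Neukirch, *Algebraic Number Theory* (1999), Ch. I §9, (9.3)–(9.6) (decomposition and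
  inertia groups, Frobenius, completely split primes). [NeukirchANT1999]
* D. A. Marcus, *Number Fields* (2018), Ch. 4, Thm. 28–29. [Marcus2018]
-/

noncomputable section

open scoped MatrixGroups Matrix Classical Polynomial NumberField Pointwise
open NumberField IsDedekindDomain Field Polynomial

namespace Literature.NumberTheory.GaloisRepresentations

/-! ## Inertia at an unramified place lies in `res(Γ_M)` -/

section InertiaRange

variable (F M : Type*) [Field F] [NumberField F] [Field M] [NumberField M] [Algebra F M]

/-- **Inertia at a place unramified in `M` lies in the image of `Γ_M → Γ_F`.**  Let `M/F` be a
finite Galois extension of number fields and `v` a finite place of `F` unramified in `M`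
(`e(v) = ramificationIdxIn v (𝓞 M) = 1`).  Then for every prime `𝔓 ∣ v` of `\bar ℤ_F` the
inertia group `I_𝔓 ≤ Γ_F` is contained in `res(Γ_M)`.  Proof: `res(Γ_M) = Gal(F̄/e(M))` for an
`F`-embedding `e : M → F̄` (`exists_mem_range_absGaloisRestrict_iff`); `M/F` being normal,
`γ ∈ Γ_F` restricts through `e` to `γ_M ∈ Gal(M/F)` with `e ∘ γ_M = γ ∘ e` (Mathlib
`AlgEquiv.restrictNormal`); if `γ ∈ I_𝔓` then `γ_M` lies in the inertia subgroup of `Gal(M/F)`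
at the prime `P = e⁻¹(𝔓) ∩ 𝓞 M` above `v`, whose order is `e(v) = 1` (Mathlib
`Ideal.card_inertia_eq_ramificationIdxIn`); so `γ_M = 1`, i.e. `γ` fixes `e(M)` pointwise.
Neukirch, *Algebraic Number Theory*, Ch. I §9, (9.6); Marcus, Ch. 4, Thm. 28.
[cite: NeukirchANT1999, Ch. I §9 (9.6)] -/
theorem inertia_le_range_absGaloisRestrict [IsGalois F M] {v : HeightOneSpectrum (𝓞 F)}
    (he : v.asIdeal.ramificationIdxIn (𝓞 M) = 1) {𝔓 : Ideal (absIntegers (𝓞 F) F)}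
    (h𝔓 : 𝔓 ∈ v.primesAbove) :
    𝔓.inertia (absoluteGaloisGroup F) ≤ (absGaloisRestrict F M).range := by
  classical
  obtain ⟨e, hrange⟩ := exists_mem_range_absGaloisRestrict_iff F M
  intro γ hγ
  rw [hrange]
  -- `M` as a subfield of `F̄` through `e`, and `γ` restricted to it
  letI : Algebra M (AlgebraicClosure F) := e.toRingHom.toAlgebra
  haveI : IsScalarTower F M (AlgebraicClosure F) :=
    IsScalarTower.of_algebraMap_eq fun x ↦ (e.commutes x).symm
  set γA : AlgebraicClosure F ≃ₐ[F] AlgebraicClosure F := absoluteGaloisGroup.toAlgEquiv F γ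
    with hγA
  set γM : M ≃ₐ[F] M := γA.restrictNormal M with hγM
  have hγM_apply : ∀ x : M, e (γM x) = γ • e x := fun x ↦
    AlgEquiv.restrictNormal_commutes γA M x
  -- the Galois group `Gal(M/F)` acting on `𝓞 M`
  haveI : Module.Finite (𝓞 F) (𝓞 M) := IsIntegralClosure.finite (𝓞 F) F M (𝓞 M)
  haveI : IsGaloisGroup (M ≃ₐ[F] M) (𝓞 F) (𝓞 M) :=
    IsGaloisGroup.of_isFractionRing (M ≃ₐ[F] M) (𝓞 F) (𝓞 M) F M
  -- the ring homomorphism `𝓞 M → \bar ℤ_F`, `y ↦ e y`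
  have hint : ∀ y : 𝓞 M, (e.toRingHom.comp (algebraMap (𝓞 M) M)) y ∈ absIntegers (𝓞 F) F := by
    intro y
    rw [mem_integralClosure_iff]
    have h1 : IsIntegral ℤ (e (y : M)) :=
      (RingOfIntegers.isIntegral_coe y).map e.toRingHom.toIntAlgHom
    exact h1.tower_top
  let ψ : 𝓞 M →+* absIntegers (𝓞 F) F :=
    (e.toRingHom.comp (algebraMap (𝓞 M) M)).codRestrict (absIntegers (𝓞 F) F) hint
  have hψ : ∀ y : 𝓞 M, ((ψ y : absIntegers (𝓞 F) F) : AlgebraicClosure F) = e (y : M) :=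
    fun _ ↦ rfl
  -- the prime `P = e⁻¹(𝔓) ∩ 𝓞 M` above `v`
  haveI : 𝔓.IsPrime := h𝔓.1
  haveI : v.asIdeal.IsPrime := v.isPrime
  set P : Ideal (𝓞 M) := 𝔓.comap ψ with hPdef
  haveI hPprime : P.IsPrime := Ideal.comap_isPrime ψ 𝔓
  have hψalg : ∀ r : 𝓞 F, ψ (algebraMap (𝓞 F) (𝓞 M) r) =
      algebraMap (𝓞 F) (absIntegers (𝓞 F) F) r := by
    intro r
    apply Subtype.ext
    rw [hψ]
    have h1 : ((algebraMap (𝓞 F) (𝓞 M) r : 𝓞 M) : M) = algebraMap F M (r : F) := by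
      rw [RingOfIntegers.coe_eq_algebraMap, RingOfIntegers.coe_eq_algebraMap,
        ← IsScalarTower.algebraMap_apply, ← IsScalarTower.algebraMap_apply]
    rw [h1, AlgHom.commutes]
    rfl
  haveI hPover : P.LiesOver v.asIdeal := by
    constructor
    ext r
    rw [h𝔓.2.over, Ideal.under, Ideal.under, Ideal.mem_comap, Ideal.mem_comap, hPdef,
      Ideal.mem_comap, hψalg]
  -- `γ_M` lies in the inertia subgroup of `Gal(M/F)` at `P` …
  have hmem : γM ∈ P.inertia (M ≃ₐ[F] M) := by
    intro y
    change γM • y - y ∈ Ideal.comap ψ 𝔓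
    rw [Ideal.mem_comap, map_sub]
    have h1 : ψ (γM • y) = γ • ψ y := by
      apply Subtype.ext
      rw [integralClosure.coe_smul, hψ, hψ, ← hγM_apply]
      congr 1
    rw [h1]
    exact hγ (ψ y)
  -- … which is trivial, `v` being unramified in `M`
  have hinertia : P.inertia (M ≃ₐ[F] M) = ⊥ := by
    apply Subgroup.eq_bot_of_card_eq
    rw [Ideal.card_inertia_eq_ramificationIdxIn (G := M ≃ₐ[F] M) v.asIdeal P, he]
  rw [hinertia, Subgroup.mem_bot] at hmem
  -- so `γ` fixes `e(M)` pointwise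
  intro x
  rw [← hγM_apply x, hmem, AlgEquiv.one_apply]

end InertiaRange

/-! ## Unramifiedness and Frobenius characteristic polynomials descend at split places -/

section Descent

variable {F M : Type*} [Field F] [NumberField F] [Field M] [NumberField M] [Algebra F M]
  {A : Type*} [CommRing A] [TopologicalSpace A] {n : ℕ}

/-- In a finite Galois extension all places above `v` have residue degree `f(v) = inertiaDegIn`
(Mathlib `Ideal.inertiaDegIn_eq_inertiaDeg`, recorded for places of number fields).
Neukirch, *Algebraic Number Theory*, Ch. I §9, (9.2). [folklore] -/
theorem inertiaDeg_eq_inertiaDegIn [IsGalois F M] {v : HeightOneSpectrum (𝓞 F)}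
    {w : HeightOneSpectrum (𝓞 M)} (hw : w.asIdeal.under (𝓞 F) = v.asIdeal) :
    w.asIdeal.inertiaDeg (𝓞 F) = v.asIdeal.inertiaDegIn (𝓞 M) := by
  haveI : Module.Finite (𝓞 F) (𝓞 M) := IsIntegralClosure.finite (𝓞 F) F M (𝓞 M)
  haveI : IsGaloisGroup (M ≃ₐ[F] M) (𝓞 F) (𝓞 M) :=
    IsGaloisGroup.of_isFractionRing (M ≃ₐ[F] M) (𝓞 F) (𝓞 M) F M
  haveI : w.asIdeal.IsPrime := w.isPrime
  haveI : w.asIdeal.LiesOver v.asIdeal := ⟨hw.symm⟩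
  exact (Ideal.inertiaDegIn_eq_inertiaDeg v.asIdeal w.asIdeal (M ≃ₐ[F] M)).symm

/-- **Unramifiedness descends from `Γ_M` at a place unramified in `M`.**  Let `M/F` be finite
Galois, `v` a finite place of `F` unramified in `M` (`ramificationIdxIn v (𝓞 M) = 1`) and
`σ : Γ_F → GL_n(A)` a framed Galois representation whose restriction `σ|_{Γ_M}` is unramified at
every place `w ∣ v` of `M`.  Then `σ` is unramified at `v`: an element of `I_𝔓`, `𝔓 ∣ v`, is
`res δ` (`inertia_le_range_absGaloisRestrict`) with `δ ∈ I_𝔔` for the prime `𝔔` of `\bar ℤ_M`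
corresponding to `𝔓` (`res⁻¹(I_𝔓) = I_𝔔`, `comap_inertia_comap_absIntegersMap`), which lies
above a place `w ∣ v`.  Neukirch, *Algebraic Number Theory*, Ch. I §9, (9.4)–(9.6).
[cite: NeukirchANT1999, Ch. I §9 (9.6)] -/
theorem FramedGaloisRep.isUnramifiedAt_of_restrictField [IsGalois F M]
    (σ : FramedGaloisRep F A n) {v : HeightOneSpectrum (𝓞 F)}
    (he : v.asIdeal.ramificationIdxIn (𝓞 M) = 1)
    (h : ∀ w : HeightOneSpectrum (𝓞 M), w.asIdeal.under (𝓞 F) = v.asIdeal →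
      (σ.restrictField M).IsUnramifiedAt w) :
    σ.IsUnramifiedAt v := by
  intro 𝔓 h𝔓 γ hγ
  obtain ⟨δ, rfl⟩ := inertia_le_range_absGaloisRestrict F M he h𝔓 hγ
  haveI : 𝔓.IsPrime := h𝔓.1
  obtain ⟨𝔔, h𝔔prime, h𝔔⟩ := exists_isPrime_comap_absIntegersMap_eq F M 𝔓
  haveI := h𝔔prime
  obtain ⟨w, hw, h𝔔w, -⟩ :=
    exists_heightOneSpectrum_of_comap_absIntegersMap_mem_primesAbove (K := F) (M := M)
      (𝔔 := 𝔔) (h𝔔.symm ▸ h𝔓)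
  have hδ : δ ∈ 𝔔.inertia (absoluteGaloisGroup M) := by
    rw [← comap_inertia_comap_absIntegersMap F M 𝔔, Subgroup.mem_comap, h𝔔]
    exact hγ
  have h1 := h w hw 𝔔 h𝔔w δ hδ
  rwa [FramedGaloisRep.restrictField_apply] at h1

/-- **Frobenius characteristic polynomials descend from `Γ_M` at a place of residue degree one.**
Let `M/F` be finite Galois, `v` a finite place of `F` whose places in `M` have residue degree
`1` (`inertiaDegIn v (𝓞 M) = 1`), and `σ : Γ_F → GL_n(A)` a framed Galois representation
unramified at `v` such that `σ|_{Γ_M}` has arithmetic-Frobenius characteristic polynomial `P` at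
every place `w ∣ v` of `M`.  Then `σ` has arithmetic-Frobenius characteristic polynomial `P` at
`v`: for `𝔓 ∣ v` take the prime `𝔔` of `\bar ℤ_M` corresponding to `𝔓`, above some `w ∣ v`,
and a Frobenius `τ ∈ Γ_M` at `𝔔`; as `f(w|v) = 1`, `res τ` is a Frobenius at `𝔓`
(`isArithFrobAt_absGaloisRestrict_of_inertiaDeg_eq_one`), any other Frobenius `φ` at `𝔓`
differs from it by inertia (Mathlib `IsArithFrobAt.mul_inv_mem_inertia`), on which `σ` is
trivial, and `σ(res τ) = σ|_{Γ_M}(τ)` has characteristic polynomial `P`.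
Neukirch, *Algebraic Number Theory*, Ch. I §9, (9.4)–(9.5); Harris–Taylor 2001, p. 231.
[cite: NeukirchANT1999, Ch. I §9 (9.5)] -/
theorem FramedGaloisRep.hasFrobCharpolyAt_of_restrictField [IsGalois F M]
    (σ : FramedGaloisRep F A n) {v : HeightOneSpectrum (𝓞 F)} (hσ : σ.IsUnramifiedAt v)
    (hf : v.asIdeal.inertiaDegIn (𝓞 M) = 1) {P : Polynomial A}
    (h : ∀ w : HeightOneSpectrum (𝓞 M), w.asIdeal.under (𝓞 F) = v.asIdeal →
      (σ.restrictField M).HasFrobCharpolyAt w P) :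
    σ.HasFrobCharpolyAt v P := by
  intro 𝔓 h𝔓 φ hφ
  haveI : 𝔓.IsPrime := h𝔓.1
  obtain ⟨𝔔, h𝔔prime, h𝔔⟩ := exists_isPrime_comap_absIntegersMap_eq F M 𝔓
  haveI := h𝔔prime
  obtain ⟨w, hw, h𝔔w, -⟩ :=
    exists_heightOneSpectrum_of_comap_absIntegersMap_mem_primesAbove (K := F) (M := M)
      (𝔔 := 𝔔) (h𝔔.symm ▸ h𝔓)
  -- `f(w|v) = 1`
  have hfw : w.asIdeal.inertiaDeg (𝓞 F) = 1 := by rw [inertiaDeg_eq_inertiaDegIn hw, hf]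
  -- a Frobenius `τ ∈ Γ_M` at `𝔔`; `res τ` is a Frobenius at `𝔓 = ι⁻¹ 𝔔`
  obtain ⟨τ, hτ⟩ := HeightOneSpectrum.exists_isArithFrobAt_of_mem_primesAbove_holds h𝔔w
  have hres : IsArithFrobAt (𝓞 F) (absGaloisRestrict F M τ) 𝔓 := by
    have h1 := isArithFrobAt_absGaloisRestrict_of_inertiaDeg_eq_one hw h𝔔w hτ hfw
    rwa [h𝔔] at h1
  -- `φ` and `res τ` differ by an element of `I_𝔓`, killed by `σ`
  have h1 := hσ 𝔓 h𝔓 _ (hφ.mul_inv_mem_inertia hres)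
  rw [map_mul, map_inv, mul_inv_eq_one] at h1
  have h2 := h w hw 𝔔 h𝔔w τ hτ
  unfold FramedRep.charpoly at h2 ⊢
  rw [FramedGaloisRep.restrictField_apply] at h2
  rw [h1]
  exact h2

end Descent

end Literature.NumberTheory.GaloisRepresentations

/-! ## Assembly: compatibility descends at completely split places -/

namespace Literature.NumberTheory.Automorphic

section Compatible

variable {n : ℕ} {K : Type} [Field K] [NumberField K] {L : Type} [Field L] [NumberField L]
  [Algebra K L] {hK : isCompact_glFiniteIntegralLevel n K}
  {hL : isCompact_glFiniteIntegralLevel n L} {ℓ : ℕ} [Fact ℓ.Prime]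

/-- **Unramified compatibility descends from a base change at a completely split place.**  Let
`L/K` be a finite Galois extension of number fields and `v` a finite place of `K` which splits
completely in `L` (`ramificationIdxIn v (𝓞 L) = 1` and `inertiaDegIn v (𝓞 L) = 1`).  Let `π`
be an automorphic representation of `GL_n(𝔸_K)` with Satake parameter `α` at `v`, `Π` an
automorphic representation of `GL_n(𝔸_L)` with Satake parameter `α` at every place `w ∣ v`
(Arthur–Clozel's relation `c(Π_w) = c(π_v)^{f(w|v)}` with `f = 1` — the base-change relation at
split places, `exists_baseChange_cyclic_split` of `BaseChangeGLn`), and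
`r : Γ_K → GL_n(ℚ̄_ℓ)` a framed Galois representation whose restriction `r|_{Γ_L}` is compatible
with `Π` at every `w ∣ v` (`IsGaloisCompatibleAt`).  Then `r` is compatible with `π` at `v`
(`IsUnramifiedAt` and `HasFrobCharpolyAt` descend, `FramedGaloisRep.isUnramifiedAt_of_restrictField`,
`FramedGaloisRep.hasFrobCharpolyAt_of_restrictField`; `q_w = q_v`; the Satake parameter of `π`
at `v` is unique, `AutomorphicRepData.hasSatakeParamAt_unique_holds`).  This is the step
"`y` splits as `y'y''` in `LA` … `[R_l(Π)|_{W_{F_y}}] = [R_l(Res Π)|_{W_{F_{y'}}}] = [r_l(ı⁻¹Π_y)]`"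
of the proof of Harris–Taylor's Thm. VII.1.9 (p. 231), i.e. of Harris–Lan–Taylor–Thorne's
Cor. 7.14 (p. 232); compatibility of `r|_{Γ_L}` is inherited from any conjugate representation
(`isGaloisCompatibleAt_conj_iff`). [folklore] -/
theorem isGaloisCompatibleAt_of_restrictField [IsGalois K L]
    (π : AutomorphicRepData (AutomorphyDatum.gl n K hK))
    (P : AutomorphicRepData (AutomorphyDatum.gl n L hL)) (ι : PadicAlgCl ℓ ≃+* ℂ)
    (r : GaloisRepresentations.FramedGaloisRep K (PadicAlgCl ℓ) n)
    {v : HeightOneSpectrum (𝓞 K)} (he : v.asIdeal.ramificationIdxIn (𝓞 L) = 1)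
    (hf : v.asIdeal.inertiaDegIn (𝓞 L) = 1) {α : Multiset ℂ} (hα : π.HasSatakeParamAt v α)
    (hP : ∀ w : HeightOneSpectrum (𝓞 L), w.asIdeal.under (𝓞 K) = v.asIdeal →
      P.HasSatakeParamAt w α)
    (h : ∀ w : HeightOneSpectrum (𝓞 L), w.asIdeal.under (𝓞 K) = v.asIdeal →
      IsGaloisCompatibleAt P ι (r.restrictField L) w) :
    IsGaloisCompatibleAt π ι r v := by
  intro β hβ
  obtain rfl : β = α := π.hasSatakeParamAt_unique_holds hβ hα
  have hur : r.IsUnramifiedAt v :=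
    r.isUnramifiedAt_of_restrictField he fun w hw ↦ (h w hw _ (hP w hw)).1
  refine ⟨hur, r.hasFrobCharpolyAt_of_restrictField hur hf fun w hw ↦ ?_⟩
  have hfw : w.asIdeal.inertiaDeg (𝓞 K) = 1 := by
    rw [GaloisRepresentations.inertiaDeg_eq_inertiaDegIn hw, hf]
  have h2 := (h w hw _ (hP w hw)).2
  rwa [GaloisRepresentations.residueCard_eq_residueCard_pow_inertiaDeg hw, hfw, pow_one] at h2

end Compatible

end Literature.NumberTheory.Automorphic
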